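import Summits.Ventures.PercRepro.C041RcPortProb

/-!
# THEOREM R, the rc reduction: the blue clusters of the terminals (p6, gen 24)

Setting of `C041RcPortDefs`.  For a configuration `S` agreeing with `O` on the bare edges, with no blue edge between
the terminals (`hab`) and no zone carrying a blue 1-edge together with a blue 2-edge (`NoDoubleZone`), the blue
cluster of `a` is `a` together with the zones of the vertices carrying a blue edge to `a` (`rc_cluster_compl_a_subset`,
converse `mem_cluster_compl_a_of_blueBareConn`); symmetrically for `b`.  Consequences: `b ∉ cluster Sᶜ a`,
`a ∉ cluster Sᶜ b`; `NoDoubleZone` holds in every `(D,A)` source (`noDoubleZone_of_not_conn`).  These are the zone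
analogues of `cluster_compl_a_subset_of_sing` (singleton family).
-/

namespace PercRepro

namespace MultiGraph

open Finset

variable {V E : Type*} {G : MultiGraph V E}

section Cluster

variable (a b : V) (O S : Config E)

/-- `u` carries a blue edge to `a`. -/
def BlueTo (G : MultiGraph V E) (a : V) (S : Config E) (u : V) : Prop := ∃ e, G.Joins e u a ∧ S e = false

/-- No zone carries a blue edge to `a` together with a blue edge to `b`. -/
def NoDoubleZone (G : MultiGraph V E) (a b : V) (O S : Config E) : Prop :=
  ∀ u u', G.BlueBareConn a b O u u' → ¬ (G.BlueTo a S u ∧ G.BlueTo b S u')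

variable {a b O S}

/-- A terminal has no bare edge: a blue bare walk from a terminal is trivial. -/
theorem eq_of_blueBareConn_terminal {u v : V} (h : G.BlueBareConn a b O u v) (hu : u = a ∨ u = b) : v = u := by
  induction h with
  | refl => rfl
  | @tail x y _ hxy ih =>
    obtain ⟨e, he, _, hj⟩ := hxy
    exfalso
    have hx := (ne_of_bare_joins he hj).1
    rw [ih] at hx
    rcases hu with hu | hu
    · exact hx.1 hu
    · exact hx.2 hu

/-- **The blue cluster of `a`**: `a` and the zones of its blue neighbours. -/
theorem rc_cluster_compl_a_subset (hagree : G.AgreeBare a b O S) (hab : ∀ e, G.Joins e a b → S e = true)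
    (hnd : G.NoDoubleZone a b O S) {v : V} (hv : v ∈ G.cluster Sᶜ a) :
    v = a ∨ ∃ u, G.BlueTo a S u ∧ G.BlueBareConn a b O u v := by
  rw [mem_cluster] at hv
  have key : ∀ v, G.Conn Sᶜ a v →
      v = a ∨ ((v ≠ a ∧ v ≠ b) ∧ ∃ u, G.BlueTo a S u ∧ G.BlueBareConn a b O u v) := by
    intro v hv
    unfold Conn at hv
    induction hv with
    | refl => exact Or.inl rfl
    | @tail z v _ hzv ih =>
      obtain ⟨e, he, hj⟩ := hzv
      have hblue : S e = false := by
        rw [compl_apply_not] at he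
        cases h : S e
        · rfl
        · rw [h] at he
          exact Bool.noConfusion he
      have hjoin : G.Joins e z v := hj
      by_cases hva : v = a
      · exact Or.inl hva
      rcases ih with hza | ⟨hz, u, hu, huz⟩
      · -- the step leaves `a`
        rw [hza] at hjoin
        by_cases hvb : v = b
        · exfalso
          have := hab e (hvb ▸ hjoin)
          rw [this] at hblue
          exact Bool.noConfusion hblue
        · exact Or.inr ⟨⟨hva, hvb⟩, v, ⟨e, hjoin.symm, hblue⟩, BlueBareConn.refl a b O v⟩
      · by_cases hvb : v = b
        · -- a blue edge from the zone of `u` to `b`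
          exfalso
          exact hnd u z huz ⟨hu, e, hvb ▸ hjoin, hblue⟩
        · -- a blue bare step
          have hbare : G.Bare a b e := by
            refine ⟨?_, ?_⟩
            · rintro (h1 | h1) <;> rcases hjoin with ⟨h2, h3⟩ | ⟨h2, h3⟩
              · exact hz.1 (h2.symm.trans h1)
              · exact hva (h2.symm.trans h1)
              · exact hva (h3.symm.trans h1)
              · exact hz.1 (h3.symm.trans h1)
            · rintro (h1 | h1) <;> rcases hjoin with ⟨h2, h3⟩ | ⟨h2, h3⟩
              · exact hz.2 (h2.symm.trans h1)
              · exact hvb (h2.symm.trans h1)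
              · exact hvb (h3.symm.trans h1)
              · exact hz.2 (h3.symm.trans h1)
          have hO : O e = false := by
            rw [← hagree e hbare]
            exact hblue
          exact Or.inr ⟨⟨hva, hvb⟩, u, hu, huz.tail ⟨e, hbare, hO, hjoin⟩⟩
  rcases key v hv with h | ⟨_, h⟩
  · exact Or.inl h
  · exact Or.inr h

/-- **The blue cluster of `b`**: `b` and the zones of its blue neighbours. -/
theorem rc_cluster_compl_b_subset (hagree : G.AgreeBare a b O S) (hab : ∀ e, G.Joins e a b → S e = true)
    (hnd : G.NoDoubleZone a b O S) {v : V} (hv : v ∈ G.cluster Sᶜ b) :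
    v = b ∨ ∃ u, G.BlueTo b S u ∧ G.BlueBareConn a b O u v := by
  rw [mem_cluster] at hv
  have key : ∀ v, G.Conn Sᶜ b v →
      v = b ∨ ((v ≠ a ∧ v ≠ b) ∧ ∃ u, G.BlueTo b S u ∧ G.BlueBareConn a b O u v) := by
    intro v hv
    unfold Conn at hv
    induction hv with
    | refl => exact Or.inl rfl
    | @tail z v _ hzv ih =>
      obtain ⟨e, he, hj⟩ := hzv
      have hblue : S e = false := by
        rw [compl_apply_not] at he
        cases h : S e
        · rfl
        · rw [h] at he
          exact Bool.noConfusion he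
      have hjoin : G.Joins e z v := hj
      by_cases hvb : v = b
      · exact Or.inl hvb
      rcases ih with hzb | ⟨hz, u, hu, huz⟩
      · rw [hzb] at hjoin
        by_cases hva : v = a
        · exfalso
          have := hab e (hva ▸ hjoin.symm)
          rw [this] at hblue
          exact Bool.noConfusion hblue
        · exact Or.inr ⟨⟨hva, hvb⟩, v, ⟨e, hjoin.symm, hblue⟩, BlueBareConn.refl a b O v⟩
      · by_cases hva : v = a
        · exfalso
          exact hnd z u huz.symm ⟨⟨e, hva ▸ hjoin, hblue⟩, hu⟩
        · have hbare : G.Bare a b e := by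
            refine ⟨?_, ?_⟩
            · rintro (h1 | h1) <;> rcases hjoin with ⟨h2, h3⟩ | ⟨h2, h3⟩
              · exact hz.1 (h2.symm.trans h1)
              · exact hva (h2.symm.trans h1)
              · exact hva (h3.symm.trans h1)
              · exact hz.1 (h3.symm.trans h1)
            · rintro (h1 | h1) <;> rcases hjoin with ⟨h2, h3⟩ | ⟨h2, h3⟩
              · exact hz.2 (h2.symm.trans h1)
              · exact hvb (h2.symm.trans h1)
              · exact hvb (h3.symm.trans h1)
              · exact hz.2 (h3.symm.trans h1)
          have hO : O e = false := by
            rw [← hagree e hbare]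
            exact hblue
          exact Or.inr ⟨⟨hva, hvb⟩, u, hu, huz.tail ⟨e, hbare, hO, hjoin⟩⟩
  rcases key v hv with h | ⟨_, h⟩
  · exact Or.inl h
  · exact Or.inr h

/-- **The converse**: the zone of a blue neighbour of `a` lies in the blue cluster of `a`. -/
theorem mem_cluster_compl_a_of_blueBareConn (hagree : G.AgreeBare a b O S) {u v : V} (hu : G.BlueTo a S u)
    (huv : G.BlueBareConn a b O u v) : v ∈ G.cluster Sᶜ a := by
  obtain ⟨e, hj, hS⟩ := hu
  rw [mem_cluster]
  refine (Conn.of_openAdj ⟨e, ?_, hj.symm⟩).trans (conn_compl_of_blueBareConn hagree huv)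
  rw [compl_apply_not, hS]
  rfl

/-- **The converse**: the zone of a blue neighbour of `b` lies in the blue cluster of `b`. -/
theorem mem_cluster_compl_b_of_blueBareConn (hagree : G.AgreeBare a b O S) {u v : V} (hu : G.BlueTo b S u)
    (huv : G.BlueBareConn a b O u v) : v ∈ G.cluster Sᶜ b := by
  obtain ⟨e, hj, hS⟩ := hu
  rw [mem_cluster]
  refine (Conn.of_openAdj ⟨e, ?_, hj.symm⟩).trans (conn_compl_of_blueBareConn hagree huv)
  rw [compl_apply_not, hS]
  rfl

/-- `b` is not in the blue cluster of `a`. -/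
theorem rc_b_not_mem_cluster_compl_a (hagree : G.AgreeBare a b O S) (hab : ∀ e, G.Joins e a b → S e = true)
    (hnd : G.NoDoubleZone a b O S) (hne : a ≠ b) : b ∉ G.cluster Sᶜ a := by
  intro h
  rcases rc_cluster_compl_a_subset hagree hab hnd h with h | ⟨u, ⟨e, hj, hS⟩, huv⟩
  · exact hne h.symm
  · by_cases hu : u = a ∨ u = b
    · have := eq_of_blueBareConn_terminal huv hu
      rcases hu with hu | hu
      · exact hne (hu ▸ this).symm
      · rw [hu] at hj
        have := hab e hj.symm
        rw [this] at hS
        exact Bool.noConfusion hS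
    · push Not at hu
      exact (ne_terminal_of_blueBareConn huv hu).2 rfl

/-- `a` is not in the blue cluster of `b`. -/
theorem rc_a_not_mem_cluster_compl_b (hagree : G.AgreeBare a b O S) (hab : ∀ e, G.Joins e a b → S e = true)
    (hnd : G.NoDoubleZone a b O S) (hne : a ≠ b) : a ∉ G.cluster Sᶜ b := by
  intro h
  rcases rc_cluster_compl_b_subset hagree hab hnd h with h | ⟨u, ⟨e, hj, hS⟩, huv⟩
  · exact hne h
  · by_cases hu : u = a ∨ u = b
    · have := eq_of_blueBareConn_terminal huv hu
      rcases hu with hu | hu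
      · rw [hu] at hj
        have := hab e hj
        rw [this] at hS
        exact Bool.noConfusion hS
      · exact hne (hu ▸ this)
    · push Not at hu
      exact (ne_terminal_of_blueBareConn huv hu).1 rfl

/-- **A `(D,A)` source has no doubly attached zone.** -/
theorem noDoubleZone_of_not_conn (hagree : G.AgreeBare a b O S) (hab : ¬ G.Conn Sᶜ a b) :
    G.NoDoubleZone a b O S := by
  rintro u u' huu' ⟨⟨e, hj, hS⟩, ⟨e', hj', hS'⟩⟩
  apply hab
  refine (Conn.of_openAdj ⟨e, ?_, hj.symm⟩).trans ((conn_compl_of_blueBareConn hagree huu').trans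
    (Conn.of_openAdj ⟨e', ?_, hj'⟩))
  · rw [compl_apply_not, hS]
    rfl
  · rw [compl_apply_not, hS']
    rfl

/-- In a source the edges between the terminals are red. -/
theorem rc_terminal_red_of_not_conn (hab : ¬ G.Conn Sᶜ a b) : ∀ e, G.Joins e a b → S e = true := by
  intro e he
  cases h : S e
  · exact absurd (Conn.of_openAdj ⟨e, by rw [compl_apply_not, h]; rfl, he⟩) hab
  · rfl

end Cluster

end MultiGraph

end PercRepro
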